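import Summits.PneNP.PneNP.Theorems.ExpanderLinearGeneratorsLinearGeneratorModPFregeHardRandomCount
import Summits.PneNP.PneNP.Theorems.ExpanderLinearGeneratorsLinearGeneratorModPFregeHardCalibration
import Summits.PneNP.PneNP.Theorems.ExpanderLinearGeneratorsLinearGeneratorResolutionSize
import Summits.PneNP.PneNP.Theses.ExpanderLinearGenerators
import Mathlib.Analysis.SpecialFunctions.Pow.Real
import Mathlib.Analysis.Complex.Exponential
import Mathlib.Data.Nat.Choose.Bounds
import Mathlib.Algebra.Order.Field.GeomSum
import HarnessLib

/-!
# Random sparse matrices are boundary expanders: instances of the rung's hypotheses exist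
(route ExpanderLinearGenerators)

Helper file for item `stmt-PneNP-11444`
(`Summit.PneNP.PneNP.Theses.ExpanderLinearGenerators.LinearGeneratorModPFregeHard`), analytic
half and assembly of the existence theorem whose counting core is
`…ModPFregeHardRandomCount.lean`. Results:

* `term_le` — the `s`-th term of the union bound is at most `(m · e^{7k} · (7ks/n)^k)^s`
  (`C(m,s) ≤ m^s`, `C(n,t) (t/n)^t ≤ t^t/t! ≤ e^t` with `t = 7ks`);
* `exists_unsolvable_expander_nat` — if `7kR ≤ n` and every bracket `(n+1) e^{7k} (7ks/n)^k`,
  `1 ≤ s ≤ R`, is `≤ 1/4`, there is an `8k`-sparse system of `n + 1` equations over `𝔽₂` in `n`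
  unknowns, `(R, 6k)`-boundary expanding (`6k = 3/4 · 8k`) and unsolvable;
* `exists_unsolvable_expander_rpow` — **the regime of the rung**: for `0 < δ` and `δk ≥ 2`, for
  all large `n` such a system exists with expansion radius `n^{1-δ}` (Krajíček's Thm. 13.3.1 with
  explicit locality `ℓ = 8k`, `k ≥ 2/δ`, and `n + 1` rows);
* `exists_unsolvable_expander_scale` — the regime of the sibling rung `ExpansionForcesDepthFregeSize`:
  for `k ≥ 2` and every real radius `r` such a system exists for some `n`;
* `linearGeneratorModPFregeHard_hypotheses_inhabited` — for every modulus `p`, every `0 < δ < 1`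
  and every depth `d ≥ 30` there is a locality `ℓ ≥ 9` such that for all large `n` the four
  hypotheses of the item (sparsity, expansion at radius `n^{1-δ}`, unsolvability, and a depth-`d`
  `textbookFrege(MOD_p)` refutation `π`) are met SIMULTANEOUSLY: together with
  `…ModPFregeHardFloor.lean` (content only at `ℓ ≥ 9`, `d ≥ 7`) this shows the item is a genuine
  lower-bound statement there, not a vacuous one; `linearGeneratorModPFregeHard_content` spells
  this out.

References: J. Krajíček, *Proof Complexity* (CUP 2019), Thm. 13.3.1 [KrajicekProofComplexity2019];
M. Alekhnovich, E. Ben-Sasson, A. A. Razborov, A. Wigderson, SIAM J. Comput. 34 (2004), Thm. 5.1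
[AlekhnovichEtAl2004].
-/

namespace Summit.PneNP.PneNP.Theorems

set_option linter.dupNamespace false -- `Summit.PneNP.PneNP.…`: summit = sub-problem (D-0017)

namespace RandomExpander

open Finset Literature.Computability.Complexity Literature.Computability.MetaComplexity

/-! ### The analytic estimate of one term of the union bound -/

/-- **One term of the union bound**: for `t = 7ks` and `n ≥ 1`,
`C(m,s) · C(n,t) · ((t/n)^s)^{8k} ≤ (m · e^{7k} · (t/n)^k)^s`, by `C(m,s) ≤ m^s`,
`C(n,t) ≤ n^t/t!`, `t^t/t! ≤ e^t = (e^{7k})^s` and `((t/n)^s)^{8k} = (t/n)^t · ((t/n)^k)^s`.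
[cite: KrajicekProofComplexity2019, Theorem 13.3.1 (proof)] -/
theorem term_le (k m s : ℕ) {n t : ℕ} (hn : 0 < n) (ht : t = 7 * k * s) :
    (m.choose s : ℝ) * (n.choose t) * ((((t : ℕ) : ℝ) / n) ^ s) ^ (8 * k)
      ≤ ((m : ℝ) * Real.exp (7 * k) * (((t : ℝ) / n) ^ k)) ^ s := by
  have hn' : (0 : ℝ) < n := by exact_mod_cast hn
  have h1 : (m.choose s : ℝ) ≤ (m : ℝ) ^ s := by exact_mod_cast Nat.choose_le_pow m s
  have h2 : (n.choose t : ℝ) * ((t : ℝ) / n) ^ t ≤ Real.exp (7 * k) ^ s := by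
    have hc : (n.choose t : ℝ) ≤ (n : ℝ) ^ t / t.factorial := Nat.choose_le_pow_div t n
    calc (n.choose t : ℝ) * ((t : ℝ) / n) ^ t ≤ ((n : ℝ) ^ t / t.factorial) * ((t : ℝ) / n) ^ t := by
          gcongr
      _ = (t : ℝ) ^ t / t.factorial := by
          rw [div_pow, div_mul_div_comm, mul_comm ((n : ℝ) ^ t) ((t : ℝ) ^ t),
            mul_div_mul_right _ _ (pow_ne_zero _ hn'.ne')]
      _ ≤ Real.exp t := Real.pow_div_factorial_le_exp (t : ℝ) (Nat.cast_nonneg t) t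
      _ = Real.exp (7 * k) ^ s := by
          rw [← Real.exp_nat_mul]
          congr 1
          rw [ht]
          push_cast
          ring
  have h3 : (((t : ℝ) / n) ^ s) ^ (8 * k) = ((t : ℝ) / n) ^ t * ((((t : ℝ) / n) ^ k)) ^ s := by
    rw [← pow_mul, ← pow_mul, ← pow_add]
    congr 1
    rw [ht]
    ring
  rw [h3]
  calc (m.choose s : ℝ) * (n.choose t) * (((t : ℝ) / n) ^ t * (((t : ℝ) / n) ^ k) ^ s)
      = (m.choose s : ℝ) * ((n.choose t) * ((t : ℝ) / n) ^ t) * (((t : ℝ) / n) ^ k) ^ s := by ring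
    _ ≤ (m : ℝ) ^ s * Real.exp (7 * k) ^ s * (((t : ℝ) / n) ^ k) ^ s := by gcongr
    _ = ((m : ℝ) * Real.exp (7 * k) * ((t : ℝ) / n) ^ k) ^ s := by ring

/-- **The union bound is below the total** once every bracket `m · e^{7k} · (7ks/n)^k`,
`1 ≤ s ≤ R`, is `≤ 1/4`: then the `s`-th term is `≤ 4^{-s}` and the sum is `≤ 1/3 < 1`.
[cite: KrajicekProofComplexity2019, Theorem 13.3.1 (proof)] -/
theorem realSum_lt_one (k m n R : ℕ) (hn : 0 < n)
    (hq : ∀ s ∈ Finset.Icc 1 R,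
      (m : ℝ) * Real.exp (7 * k) * ((((7 * k * s : ℕ) : ℝ) / n) ^ k) ≤ 1 / 4) :
    ∑ s ∈ Finset.Icc 1 R, (m.choose s : ℝ) * (n.choose (7 * k * s)) *
      ((((7 * k * s : ℕ) : ℝ) / n) ^ s) ^ (8 * k) < 1 := by
  calc ∑ s ∈ Finset.Icc 1 R, (m.choose s : ℝ) * (n.choose (7 * k * s)) *
        ((((7 * k * s : ℕ) : ℝ) / n) ^ s) ^ (8 * k)
      ≤ ∑ s ∈ Finset.Icc 1 R, (1 / 4 : ℝ) ^ s :=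
        Finset.sum_le_sum fun s hs =>
          (term_le k m s hn rfl).trans (pow_le_pow_left₀ (by positivity) (hq s hs) s)
    _ < 1 := by
        rw [← Finset.Ico_add_one_right_eq_Icc]
        calc ∑ s ∈ Finset.Ico 1 (R + 1), (1 / 4 : ℝ) ^ s ≤ (1 / 4 : ℝ) ^ 1 / (1 - 1 / 4) :=
              geom_sum_Ico_le_of_lt_one (by norm_num) (by norm_num)
          _ < 1 := by norm_num

/-- **From the real inequality to the counting inequality** used by
`exists_coverExpanding_picks`: multiplying through by `n^{8km}` (terms with `s > m` vanish).
[folklore] -/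
theorem natSum_lt_of_realSum_lt_one (k m n R : ℕ) (hn : 0 < n)
    (h : ∑ s ∈ Finset.Icc 1 R, (m.choose s : ℝ) * (n.choose (7 * k * s)) *
      ((((7 * k * s : ℕ) : ℝ) / n) ^ s) ^ (8 * k) < 1) :
    ∑ s ∈ Finset.Icc 1 R,
        m.choose s * (n.choose (7 * k * s) * ((7 * k * s) ^ s * n ^ (m - s)) ^ (8 * k))
      < n ^ (m * (8 * k)) := by
  have hn' : (0 : ℝ) < n := by exact_mod_cast hn
  have key : ∀ s ∈ Finset.Icc 1 R,
      (((m.choose s * (n.choose (7 * k * s) * ((7 * k * s) ^ s * n ^ (m - s)) ^ (8 * k))) : ℕ) : ℝ)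
        ≤ (n : ℝ) ^ (m * (8 * k)) * ((m.choose s : ℝ) * (n.choose (7 * k * s)) *
            ((((7 * k * s : ℕ) : ℝ) / n) ^ s) ^ (8 * k)) := by
    intro s _
    rcases le_or_gt s m with hsm | hsm
    · apply le_of_eq
      have hnm : (n : ℝ) ^ (m * (8 * k)) = ((n : ℝ) ^ s) ^ (8 * k) * ((n : ℝ) ^ (m - s)) ^ (8 * k) := by
        rw [← mul_pow, ← pow_add, Nat.add_sub_cancel' hsm, pow_mul]
      rw [hnm, div_pow, div_pow]
      push_cast
      field_simp
      ring
    · rw [Nat.choose_eq_zero_of_lt hsm]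
      simp only [zero_mul, Nat.cast_zero]
      positivity
  have hlt : ((∑ s ∈ Finset.Icc 1 R, m.choose s *
      (n.choose (7 * k * s) * ((7 * k * s) ^ s * n ^ (m - s)) ^ (8 * k)) : ℕ) : ℝ)
        < ((n ^ (m * (8 * k)) : ℕ) : ℝ) := by
    rw [Nat.cast_sum, Nat.cast_pow]
    calc ∑ s ∈ Finset.Icc 1 R,
          (((m.choose s * (n.choose (7 * k * s) * ((7 * k * s) ^ s * n ^ (m - s)) ^ (8 * k))) : ℕ) : ℝ)
        ≤ ∑ s ∈ Finset.Icc 1 R, (n : ℝ) ^ (m * (8 * k)) * ((m.choose s : ℝ) * (n.choose (7 * k * s)) *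
            ((((7 * k * s : ℕ) : ℝ) / n) ^ s) ^ (8 * k)) := Finset.sum_le_sum key
      _ = (n : ℝ) ^ (m * (8 * k)) * ∑ s ∈ Finset.Icc 1 R, (m.choose s : ℝ) * (n.choose (7 * k * s)) *
            ((((7 * k * s : ℕ) : ℝ) / n) ^ s) ^ (8 * k) := by rw [Finset.mul_sum]
      _ < (n : ℝ) ^ (m * (8 * k)) * 1 := by gcongr
      _ = (n : ℝ) ^ (m * (8 * k)) := mul_one _
  exact_mod_cast hlt

/-- **Assembly at an integer radius.** If `7kR ≤ n` and every bracket
`(n+1) · e^{7k} · (7ks/n)^k`, `1 ≤ s ≤ R`, is `≤ 1/4`, there is an `8k`-sparse system of `n + 1`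
linear equations over `𝔽₂` in `n` unknowns whose supports form an `(R, 3/4 · 8k)`-boundary
expander and which is unsolvable. [cite: KrajicekProofComplexity2019, Theorem 13.3.1] -/
theorem exists_unsolvable_expander_nat (k n R : ℕ) (hn : 0 < n) (hR : 7 * k * R ≤ n)
    (hq : ∀ s ∈ Finset.Icc 1 R,
      ((n + 1 : ℕ) : ℝ) * Real.exp (7 * k) * ((((7 * k * s : ℕ) : ℝ) / n) ^ k) ≤ 1 / 4) :
    ∃ E : Fin (n + 1) → LinEqMod 2 n, (∀ i, (E i).supp.card ≤ 8 * k) ∧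
      IsBoundaryExpander (fun i => (E i).supp.map Fin.valEmbedding) (R : ℝ)
        (3 / 4 * ((8 * k : ℕ) : ℝ)) ∧
      ¬ SystemSat E Finset.univ := by
  obtain ⟨f, hf⟩ := exists_coverExpanding_picks k (n + 1) n R hR
    (natSum_lt_of_realSum_lt_one k (n + 1) n R hn (realSum_lt_one k (n + 1) n R hn hq))
  exact exists_system_of_picks f hf

/-! ### The two regimes -/

/-- The closing numerical step shared by both regimes: if `P ≤ A/n²` and `n ≥ 8·E·A` then
`(n+1) · E · P ≤ 1/4`. [folklore] -/
theorem bracket_le_quarter {n : ℕ} (hn : 0 < n) {E A P : ℝ} (hE : 0 ≤ E) (hA : 0 ≤ A)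
    (hP : P ≤ A / (n : ℝ) ^ 2) (hC : 8 * E * A ≤ n) : ((n + 1 : ℕ) : ℝ) * E * P ≤ 1 / 4 := by
  have hn' : (0 : ℝ) < n := by exact_mod_cast hn
  have h1 : ((n + 1 : ℕ) : ℝ) ≤ 2 * n := by
    have : (1 : ℝ) ≤ n := by exact_mod_cast hn
    push_cast
    linarith
  calc ((n + 1 : ℕ) : ℝ) * E * P ≤ ((n + 1 : ℕ) : ℝ) * E * (A / (n : ℝ) ^ 2) :=
        mul_le_mul_of_nonneg_left hP (mul_nonneg (Nat.cast_nonneg _) hE)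
    _ ≤ 2 * n * E * (A / (n : ℝ) ^ 2) :=
        mul_le_mul_of_nonneg_right (mul_le_mul_of_nonneg_right h1 hE) (div_nonneg hA (sq_nonneg _))
    _ = 2 * E * A / n := by
        field_simp
    _ ≤ 1 / 4 := by
        rw [div_le_iff₀ hn']
        linarith

/-- **Brackets in the polynomial regime.** For `0 < δ`, `k ≥ 1` with `δk ≥ 2` and all large `n`:
`7k ⌊n^{1-δ}⌋ ≤ n`, and `(n+1) · e^{7k} · (7ks/n)^k ≤ 1/4` for `1 ≤ s ≤ ⌊n^{1-δ}⌋`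
(since `(7ks/n)^k ≤ (7k)^k n^{-δk} ≤ (7k)^k / n²`). [folklore] -/
theorem brackets_rpow {δ : ℝ} (hδ : 0 < δ) {k : ℕ} (hk : 1 ≤ k) (hδk : 2 ≤ δ * k) :
    ∃ N : ℕ, ∀ n : ℕ, N ≤ n → 0 < n ∧ 7 * k * ⌊(n : ℝ) ^ (1 - δ)⌋₊ ≤ n ∧
      ∀ s ∈ Finset.Icc 1 ⌊(n : ℝ) ^ (1 - δ)⌋₊,
        ((n + 1 : ℕ) : ℝ) * Real.exp (7 * k) * ((((7 * k * s : ℕ) : ℝ) / n) ^ k) ≤ 1 / 4 := by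
  set A : ℝ := (7 * k : ℝ) ^ k with hA
  have hA0 : 0 ≤ A := by positivity
  refine ⟨max (max 1 ⌈(7 * k : ℝ) ^ (1 / δ)⌉₊) ⌈8 * Real.exp (7 * k) * A⌉₊, fun n hn => ?_⟩
  have hn1 : 1 ≤ n := le_trans (le_max_left _ _ |>.trans' (le_max_left _ _)) hn
  have hn0 : 0 < n := hn1
  have hn' : (0 : ℝ) < n := by exact_mod_cast hn0
  have hn1' : (1 : ℝ) ≤ n := by exact_mod_cast hn1
  have hceil : ⌈(7 * k : ℝ) ^ (1 / δ)⌉₊ ≤ n := le_trans ((le_max_right _ _).trans (le_max_left _ _)) hn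
  have hC : 8 * Real.exp (7 * k) * A ≤ n := (Nat.le_ceil _).trans (by exact_mod_cast (le_max_right _ _).trans hn)
  -- `7k ≤ n^δ`
  have h7k : (7 * k : ℝ) ≤ (n : ℝ) ^ δ := le_rpow_of_ceil_le (by positivity) hδ hceil
  have hfl : (⌊(n : ℝ) ^ (1 - δ)⌋₊ : ℝ) ≤ (n : ℝ) ^ (1 - δ) := Nat.floor_le (by positivity)
  refine ⟨hn0, ?_, fun s hs => ?_⟩
  · have h : ((7 * k * ⌊(n : ℝ) ^ (1 - δ)⌋₊ : ℕ) : ℝ) ≤ n := by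
      push_cast
      calc (7 * k : ℝ) * ⌊(n : ℝ) ^ (1 - δ)⌋₊ ≤ (n : ℝ) ^ δ * (n : ℝ) ^ (1 - δ) := by gcongr
        _ = n := by rw [← Real.rpow_add hn']; norm_num
    exact_mod_cast h
  · have hs1 : (s : ℝ) ≤ (n : ℝ) ^ (1 - δ) :=
      le_trans (by exact_mod_cast (Finset.mem_Icc.1 hs).2) hfl
    -- `(7ks/n)^k ≤ (7k)^k · n^{-δk} ≤ (7k)^k / n²`
    have hfrac : ((7 * k * s : ℕ) : ℝ) / n ≤ 7 * k * (n : ℝ) ^ (-δ) := by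
      push_cast
      rw [mul_div_assoc]
      gcongr
      rw [div_le_iff₀ hn', show -δ = (1 - δ) - 1 by ring, Real.rpow_sub_one hn'.ne',
        div_mul_cancel₀ _ hn'.ne']
      exact hs1
    have hP : (((7 * k * s : ℕ) : ℝ) / n) ^ k ≤ A / (n : ℝ) ^ 2 := by
      calc (((7 * k * s : ℕ) : ℝ) / n) ^ k ≤ (7 * k * (n : ℝ) ^ (-δ)) ^ k := by gcongr
        _ = A * (n : ℝ) ^ (-δ * k) := by
            rw [mul_pow, hA, Real.rpow_mul_natCast hn'.le]
        _ ≤ A * (n : ℝ) ^ (-2 : ℝ) :=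
            mul_le_mul_of_nonneg_left (Real.rpow_le_rpow_of_exponent_le hn1' (by linarith)) hA0
        _ = A / (n : ℝ) ^ 2 := by
            rw [Real.rpow_neg hn'.le, div_eq_mul_inv]
            norm_num
    exact bracket_le_quarter hn0 (Real.exp_pos _).le hA0 hP hC

/-- **Brackets at a fixed radius.** For `k ≥ 2` and every `R` there is `n ≥ 7kR`, `n > 0`, with
`(n+1) · e^{7k} · (7ks/n)^k ≤ 1/4` for `1 ≤ s ≤ R` (since `(7ks/n)^k ≤ (7kR)^k / n²`).
[folklore] -/
theorem brackets_scale {k : ℕ} (hk : 2 ≤ k) (R : ℕ) :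
    ∃ n : ℕ, 0 < n ∧ 7 * k * R ≤ n ∧ ∀ s ∈ Finset.Icc 1 R,
      ((n + 1 : ℕ) : ℝ) * Real.exp (7 * k) * ((((7 * k * s : ℕ) : ℝ) / n) ^ k) ≤ 1 / 4 := by
  set A : ℝ := (7 * k * R : ℝ) ^ k with hA
  have hA0 : 0 ≤ A := by positivity
  refine ⟨max (7 * k * R) ⌈8 * Real.exp (7 * k) * A⌉₊ + 1, Nat.succ_pos _,
    (le_max_left _ _).trans (Nat.le_succ _), fun s hs => ?_⟩
  set n : ℕ := max (7 * k * R) ⌈8 * Real.exp (7 * k) * A⌉₊ + 1 with hn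
  have hn0 : 0 < n := Nat.succ_pos _
  have hn' : (0 : ℝ) < n := by exact_mod_cast hn0
  have hn1' : (1 : ℝ) ≤ n := by exact_mod_cast hn0
  have hC : 8 * Real.exp (7 * k) * A ≤ n :=
    (Nat.le_ceil _).trans (by exact_mod_cast ((le_max_right _ _).trans (Nat.le_succ _) : _ ≤ n))
  have hsR : (s : ℝ) ≤ R := by exact_mod_cast (Finset.mem_Icc.1 hs).2
  have hP : (((7 * k * s : ℕ) : ℝ) / n) ^ k ≤ A / (n : ℝ) ^ 2 := by
    calc (((7 * k * s : ℕ) : ℝ) / n) ^ k ≤ ((7 * k * R : ℝ) / n) ^ k := by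
          push_cast
          gcongr
      _ = A / (n : ℝ) ^ k := by rw [div_pow, hA]
      _ ≤ A / (n : ℝ) ^ 2 :=
          div_le_div_of_nonneg_left hA0 (by positivity) (pow_le_pow_right₀ hn1' hk)
  exact bracket_le_quarter hn0 (Real.exp_pos _).le hA0 hP hC

/-! ### The existence theorems -/

/-- **Sparse unsolvable boundary expanders at radius `n^{1-δ}` (Krajíček's Theorem 13.3.1, the
regime of the rungs `LinearGeneratorDepthFregeHard` / `LinearGeneratorModPFregeHard`).** For
`0 < δ` and every `k ≥ 1` with `δk ≥ 2`, for all sufficiently large `n` there is a system of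
`n + 1` linear equations over `𝔽₂` in `n` unknowns with row supports of size `≤ 8k` forming an
`(n^{1-δ}, 3/4 · 8k)`-boundary expander, and with no solution.
[cite: KrajicekProofComplexity2019, Theorem 13.3.1] -/
theorem exists_unsolvable_expander_rpow {δ : ℝ} (hδ : 0 < δ) {k : ℕ} (hk : 1 ≤ k)
    (hδk : 2 ≤ δ * k) :
    ∃ N : ℕ, ∀ n : ℕ, N ≤ n → ∃ E : Fin (n + 1) → LinEqMod 2 n,
      (∀ i, (E i).supp.card ≤ 8 * k) ∧
      IsBoundaryExpander (fun i => (E i).supp.map Fin.valEmbedding) ((n : ℝ) ^ (1 - δ))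
        (3 / 4 * ((8 * k : ℕ) : ℝ)) ∧
      ¬ SystemSat E Finset.univ := by
  obtain ⟨N, hN⟩ := brackets_rpow hδ hk hδk
  refine ⟨N, fun n hn => ?_⟩
  obtain ⟨hn0, hR, hq⟩ := hN n hn
  obtain ⟨E, hsp, hexp, hunsat⟩ := exists_unsolvable_expander_nat k n _ hn0 hR hq
  exact ⟨E, hsp, isBoundaryExpander_of_floor _ hexp, hunsat⟩

/-- **Sparse unsolvable boundary expanders at every fixed radius (the regime of the rung
`ExpansionForcesDepthFregeSize`).** For `k ≥ 2` and every real `r` there are `n` and a system of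
`n + 1` linear equations over `𝔽₂` in `n` unknowns, `8k`-sparse, `(r, 3/4 · 8k)`-boundary
expanding, unsolvable. [cite: KrajicekProofComplexity2019, Theorem 13.3.1] -/
theorem exists_unsolvable_expander_scale {k : ℕ} (hk : 2 ≤ k) (r : ℝ) :
    ∃ (n : ℕ) (E : Fin (n + 1) → LinEqMod 2 n), (∀ i, (E i).supp.card ≤ 8 * k) ∧
      IsBoundaryExpander (fun i => (E i).supp.map Fin.valEmbedding) r (3 / 4 * ((8 * k : ℕ) : ℝ)) ∧
      ¬ SystemSat E Finset.univ := by
  obtain ⟨n, hn0, hR, hq⟩ := brackets_scale hk ⌊r⌋₊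
  obtain ⟨E, hsp, hexp, hunsat⟩ := exists_unsolvable_expander_nat k n _ hn0 hR hq
  exact ⟨n, E, hsp, isBoundaryExpander_of_floor _ hexp, hunsat⟩

/-! ### The hypotheses of the rung are jointly satisfiable -/

/-- **For every `0 < δ < 1` there is a locality `ℓ ≥ 9` at which the instances of the rungs
exist for all large `n`** (`ℓ = 8(⌈2/δ⌉ + 1)`): `ℓ`-sparse, `(n^{1-δ}, 3/4·ℓ)`-boundary
expanding, unsolvable systems over `𝔽₂`. [cite: KrajicekProofComplexity2019, Theorem 13.3.1] -/
theorem exists_locality_with_instances {δ : ℝ} (hδ : 0 < δ) :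
    ∃ ℓ : ℕ, 9 ≤ ℓ ∧ ∃ N : ℕ, ∀ n : ℕ, N ≤ n → ∃ (m : ℕ) (E : Fin m → LinEqMod 2 n),
      (∀ i, (E i).supp.card ≤ ℓ) ∧
      IsBoundaryExpander (fun i => (E i).supp.map Fin.valEmbedding) ((n : ℝ) ^ (1 - δ))
        (3 / 4 * ℓ) ∧
      ¬ SystemSat E Finset.univ := by
  set k : ℕ := ⌈2 / δ⌉₊ + 1 with hk
  have hk1 : 1 ≤ k := Nat.le_add_left _ _
  have hδk : 2 ≤ δ * k := by
    have h1 : 2 / δ ≤ (⌈2 / δ⌉₊ : ℝ) := Nat.le_ceil _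
    have h2 : (k : ℝ) = (⌈2 / δ⌉₊ : ℝ) + 1 := by rw [hk]; push_cast; ring
    rw [h2]
    calc (2 : ℝ) = δ * (2 / δ) := by field_simp
      _ ≤ δ * ((⌈2 / δ⌉₊ : ℝ) + 1) := by gcongr; linarith
  have hk2 : 2 ≤ k := by
    have : 1 ≤ ⌈2 / δ⌉₊ := Nat.one_le_iff_ne_zero.2 (Nat.ceil_pos.2 (by positivity)).ne'
    omega
  obtain ⟨N, hN⟩ := exists_unsolvable_expander_rpow hδ hk1 hδk
  refine ⟨8 * k, by omega, N, fun n hn => ?_⟩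
  obtain ⟨E, hsp, hexp, hunsat⟩ := hN n hn
  exact ⟨n + 1, E, hsp, hexp, hunsat⟩

/-- **The hypotheses of `LinearGeneratorModPFregeHard` are jointly satisfiable.** For every
modulus `p`, every `0 < δ` and every depth `d ≥ 30` there is a locality `ℓ ≥ 9` such that for all
large `n` some `ℓ`-sparse `(n^{1-δ}, 3/4·ℓ)`-boundary-expanding unsolvable system `E` over `𝔽₂`
in `n` unknowns AND a depth-`d` `textbookFrege(MOD_p)` proof of `¬ ofCNF (sumEncoding 1 E)`
exist (`exists_isModDepthProofOf_sumEncoding`): at such `(p, ℓ, d, δ)` the item asserts a genuine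
(non-vacuous) lower bound — all of its content lives at `ℓ ≥ 9`, `d ≥ 7`
(`…ModPFregeHardFloor.lean`), and is an instance of Krajíček's open Problem 15.6.1.
[cite: KrajicekProofComplexity2019, Theorem 13.3.1] -/
theorem linearGeneratorModPFregeHard_hypotheses_inhabited (p : ℕ) {δ : ℝ} (hδ : 0 < δ) {d : ℕ}
    (hd : 30 ≤ d) :
    ∃ ℓ : ℕ, 9 ≤ ℓ ∧ ∃ N : ℕ, ∀ n : ℕ, N ≤ n →
      ∃ (m : ℕ) (E : Fin m → LinEqMod 2 n) (π : List (PropFormMod p ℕ)),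
        (∀ i, (E i).supp.card ≤ ℓ) ∧
        IsBoundaryExpander (fun i => (E i).supp.map Fin.valEmbedding) ((n : ℝ) ^ (1 - δ))
          (3 / 4 * ℓ) ∧
        ¬ SystemSat E Finset.univ ∧
        textbookFrege.IsModDepthProofOf d π
          (PropFormMod.ofPropForm (PropForm.neg (PropForm.ofCNF (sumEncoding 1 E)))) := by
  obtain ⟨ℓ, hℓ, N, hN⟩ := exists_locality_with_instances hδ
  refine ⟨ℓ, hℓ, N, fun n hn => ?_⟩
  obtain ⟨m, E, hsp, hexp, hunsat⟩ := hN n hn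
  obtain ⟨π, hπ⟩ := exists_isModDepthProofOf_sumEncoding p E hunsat hd
  exact ⟨m, E, π, hsp, hexp, hunsat, hπ⟩

open Summit.PneNP.PneNP.Theses.ExpanderLinearGenerators in
/-- **The content of the item.** If `LinearGeneratorModPFregeHard` holds then for every odd prime
`p`, every `0 < δ < 1` and every depth `d ≥ 30` there are a locality `ℓ`, an `ε > 0` and a
threshold beyond which, for every `n`, instances `E` satisfying all hypotheses of the item exist,
each has depth-`d` `textbookFrege(MOD_p)` refutations, and EVERY such refutation has size
`≥ 2^{n^ε}` — a genuine exponential lower bound for `AC⁰[p]`-Frege on an explicit sequence of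
tautologies, i.e. a positive solution of an instance of Krajíček's Problem 15.6.1.
[cite: KrajicekProofComplexity2019, Problem 15.6.1] -/
theorem linearGeneratorModPFregeHard_content (h : LinearGeneratorModPFregeHard) (p : ℕ)
    (hp : p.Prime) (hp2 : p ≠ 2) {δ : ℝ} (hδ : 0 < δ) (hδ1 : δ < 1) {d : ℕ} (hd : 30 ≤ d) :
    ∃ (ℓ : ℕ) (ε : ℝ) (N : ℕ), 0 < ε ∧ ∀ n : ℕ, N ≤ n →
      ∃ (m : ℕ) (E : Fin m → LinEqMod 2 n),
        (∀ i, (E i).supp.card ≤ ℓ) ∧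
        IsBoundaryExpander (fun i => (E i).supp.map Fin.valEmbedding) ((n : ℝ) ^ (1 - δ))
          (3 / 4 * ℓ) ∧
        ¬ SystemSat E Finset.univ ∧
        (∃ π : List (PropFormMod p ℕ), textbookFrege.IsModDepthProofOf d π
          (PropFormMod.ofPropForm (PropForm.neg (PropForm.ofCNF (sumEncoding 1 E))))) ∧
        ∀ π : List (PropFormMod p ℕ), textbookFrege.IsModDepthProofOf d π
          (PropFormMod.ofPropForm (PropForm.neg (PropForm.ofCNF (sumEncoding 1 E)))) →
          (2 : ℝ) ^ ((n : ℝ) ^ ε) ≤ (modProofSize π : ℝ) := by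
  obtain ⟨ℓ, hℓ, N₁, hN₁⟩ := linearGeneratorModPFregeHard_hypotheses_inhabited p hδ hd
  obtain ⟨ε, hε, N₂, hN₂⟩ := h p hp hp2 ℓ d δ (by omega) hδ hδ1
  refine ⟨ℓ, ε, max N₁ N₂, hε, fun n hn => ?_⟩
  obtain ⟨m, E, π, hsp, hexp, hunsat, hπ⟩ := hN₁ n ((le_max_left _ _).trans hn)
  exact ⟨m, E, hsp, hexp, hunsat, ⟨π, hπ⟩,
    fun π' hπ' => hN₂ n ((le_max_right _ _).trans hn) m E hsp hexp hunsat π' hπ'⟩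

end RandomExpander

end Summit.PneNP.PneNP.Theorems
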